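import Literature.Probability.LatticeModels.TriangularIsoradialEmbedding
import HarnessLib

/-!
# Route CardyBondTriangular — item `BondTriangularBoxCrossing`: fitting lattice events of `𝕋` into Euclidean boxes

Layer D: the aspect-ratio-2 lower bounds `hLR`, `hTB` of `hasBoxCrossingProperty_of_aspect_two`
for critical bond percolation on `𝕋` drawn by `triIsoradialEmbedding`
(`z (x₀, x₁) = (√3/2)(2x₀ + x₁ − 1) + i (3x₁ − 1)/2`): every Euclidean `2n × n` box is crossed
horizontally (a translate of the slab crossing `exists_le_real_slabCrossing 5`, clipped by
`embRectCrossing_of_openCrossing`) and every `n × 2n` box vertically (the zigzag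
`exists_le_real_zigzag 7`, clipped by `embTBCrossing_of_openCrossing`) with probability bounded
below, uniformly in the position `w` of the box and in `n ≥ n₀`. The lattice events are chosen
with margins (`lr_fit`, `tb_fit`) so that the same events serve the hexagonal dual (layer E).
-/

noncomputable section

namespace Summit.CriticalPhenomena.CardyFormulaZ2.Theorems.TriSweep

open MeasureTheory Literature.Probability.LatticeModels Literature.Probability.Percolation Real
open Complex (I)

/-! ### Coordinates of the drawing -/

/-- The real part of the position of a vertex of `𝕋`. -/
theorem z_re (x : Site 2) :
    (triIsoradialEmbedding.z x).re = Real.sqrt 3 / 2 * (2 * x 0 + x 1 - 1) := by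
  change ((Real.sqrt 3 : ℂ) * (triEmbed x - (1 + triZeta) / 3)).re = _
  simp [triEmbed, triZeta_re, triZeta_im]
  ring

/-- The imaginary part of the position of a vertex of `𝕋`. -/
theorem z_im (x : Site 2) : (triIsoradialEmbedding.z x).im = (3 * x 1 - 1) / 2 := by
  have h3 : Real.sqrt 3 * Real.sqrt 3 = 3 := Real.mul_self_sqrt (by norm_num)
  change ((Real.sqrt 3 : ℂ) * (triEmbed x - (1 + triZeta) / 3)).im = _
  simp [triEmbed, triZeta_re, triZeta_im]
  linear_combination ((x 1 : ℝ) / 2 - 1 / 6) * h3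

/-- `17/10 < √3`. -/
theorem sqrt3_gt : (17 / 10 : ℝ) < Real.sqrt 3 := by
  rw [show (17 / 10 : ℝ) = Real.sqrt ((17 / 10) ^ 2) by rw [Real.sqrt_sq (by norm_num)]]
  exact Real.sqrt_lt_sqrt (by norm_num) (by norm_num)

/-- `√3 < 7/4`. -/
theorem sqrt3_lt : Real.sqrt 3 < 7 / 4 := by
  rw [show (7 / 4 : ℝ) = Real.sqrt ((7 / 4) ^ 2) by rw [Real.sqrt_sq (by norm_num)]]
  exact Real.sqrt_lt_sqrt (by norm_num) (by norm_num)

/-! ### Fitting the slab crossing into a `2n × n` box -/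

/-- **The translated slab fits the box `w + [0, 2n] × [0, n]` with margins.** With
`3N + 8 ≤ 2n ≤ 3N + 10`, `m₀ = ⌈(2 im w + 1)/3⌉`, `b₀ = ⌈(re w + 2n)/√3 − m₀/2 − 2N⌉` and `n ≥ 11`,
the slab of rows `1, …, N + 1` translated by `(b₀, m₀)` is drawn in the horizontal strip
`im w + [3/2, n − 1]`, its start set in `{re ≤ re w − √3}` and its end set in `{re w + 2n ≤ re}`. -/
theorem lr_fit {n N : ℕ} {w : ℂ} {m₀ b₀ : ℤ} (hn : (11 : ℝ) ≤ n) (hN : 3 * (N : ℝ) + 8 ≤ 2 * n)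
    (hN' : 2 * (n : ℝ) ≤ 3 * N + 10) (hm₀ : 2 * w.im + 1 ≤ 3 * m₀) (hm₀' : 3 * (m₀ : ℝ) < 2 * w.im + 4)
    (hb₀ : (w.re + 2 * n) * Real.sqrt 3 / 3 - m₀ / 2 - 2 * N ≤ b₀)
    (hb₀' : (b₀ : ℝ) < (w.re + 2 * n) * Real.sqrt 3 / 3 - m₀ / 2 - 2 * N + 1) :
    (∀ x : Site 2, 1 ≤ x 1 → x 1 ≤ (N : ℤ) + 1 →
      (triIsoradialEmbedding.z (x + ![b₀, m₀]) - w).im ∈ Set.Icc (3 / 2 : ℝ) (n - 1)) ∧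
    (∀ x : Site 2, x 1 = 1 → 2 * x 0 ≤ -(4 * N : ℤ) →
      (triIsoradialEmbedding.z (x + ![b₀, m₀]) - w).re ≤ -Real.sqrt 3) ∧
    (∀ x : Site 2, x 1 = 1 → (4 * N : ℤ) ≤ 2 * x 0 →
      2 * n ≤ (triIsoradialEmbedding.z (x + ![b₀, m₀]) - w).re) := by
  set s := Real.sqrt 3 with hs
  have hs0 : 0 < s := lt_trans (by norm_num) sqrt3_gt
  have hs17 := sqrt3_gt
  have hss : Real.sqrt 3 * Real.sqrt 3 = 3 := Real.mul_self_sqrt (by norm_num)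
  have key : s * ((w.re + 2 * n) * s / 3) = w.re + 2 * n := by
    rw [show s * ((w.re + 2 * n) * s / 3) = (w.re + 2 * n) * (s * s) / 3 by ring, hss]; ring
  refine ⟨fun x h1 h2 => ?_, fun x h1 h2 => ?_, fun x h1 h2 => ?_⟩
  · rw [Complex.sub_im, z_im]
    have h1' : (1 : ℝ) ≤ x 1 := by exact_mod_cast h1
    have h2' : (x 1 : ℝ) ≤ N + 1 := by exact_mod_cast h2
    simp only [Pi.add_apply, Matrix.cons_val_one, Matrix.cons_val_zero, Int.cast_add]
    constructor <;> linarith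
  · rw [Complex.sub_re, z_re]
    have h2' : 2 * (x 0 : ℝ) ≤ -(4 * N) := by exact_mod_cast h2
    simp only [Pi.add_apply, Matrix.cons_val_one, Matrix.cons_val_zero, Int.cast_add, h1,
      Int.cast_one]
    have e1 : s / 2 * (2 * (↑(x 0) + ↑b₀) + (1 + ↑m₀) - 1) = s * (x 0 : ℝ) + s * b₀ + s * m₀ / 2 := by ring
    rw [e1]
    have i1 : s * (x 0 : ℝ) ≤ s * (-(2 * N)) := mul_le_mul_of_nonneg_left (by linarith) hs0.le
    have i2 : s * (b₀ : ℝ) < s * ((w.re + 2 * n) * s / 3 - m₀ / 2 - 2 * N + 1) :=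
      mul_lt_mul_of_pos_left hb₀' hs0
    have i3 : s * ((w.re + 2 * n) * s / 3 - m₀ / 2 - 2 * N + 1) =
        w.re + 2 * n - s * m₀ / 2 - 2 * (s * N) + s := by linear_combination key
    have i4 : (2 : ℝ) * n + 2 * s ≤ 4 * (s * N) := by nlinarith
    nlinarith
  · rw [Complex.sub_re, z_re]
    have h2' : (4 * N : ℝ) ≤ 2 * (x 0 : ℝ) := by exact_mod_cast h2
    simp only [Pi.add_apply, Matrix.cons_val_one, Matrix.cons_val_zero, Int.cast_add, h1,
      Int.cast_one]
    have e1 : s / 2 * (2 * (↑(x 0) + ↑b₀) + (1 + ↑m₀) - 1) = s * (x 0 : ℝ) + s * b₀ + s * m₀ / 2 := by ring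
    rw [e1]
    have i1 : s * (2 * N : ℝ) ≤ s * (x 0 : ℝ) := mul_le_mul_of_nonneg_left (by linarith) hs0.le
    have i2 : s * ((w.re + 2 * n) * s / 3 - m₀ / 2 - 2 * N) ≤ s * (b₀ : ℝ) :=
      mul_le_mul_of_nonneg_left hb₀ hs0.le
    have i3 : s * ((w.re + 2 * n) * s / 3 - m₀ / 2 - 2 * N) =
        w.re + 2 * n - s * m₀ / 2 - 2 * (s * N) := by linear_combination key
    nlinarith

/-! ### Fitting the zigzag into an `n × 2n` box -/

/-- **The zigzag fits the box `w + [0, n] × [0, 2n]` with margins.** With `8N + 16 ≤ n < 8N + 24`,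
`N ≥ 7`, `r₀ = ⌊(2 im w − 1)/3⌋`, `T = ⌈2 re w/√3⌉`, `a₀ = ⌈(T + N + 5 − r₀)/2⌉`, the slanted strip
`{2a₀ + r₀ − N ≤ 2x₀ + x₁ ≤ 2a₀ + r₀ + 8N (+1)}` is drawn in the vertical strip
`re w + [2√3, n − 3√3/2]`, the row `r₀` in `{im ≤ im w − 1}` and the row `r₀ + 16N` in
`{im w + 2n ≤ im}`. -/
theorem tb_fit {n N : ℕ} {w : ℂ} {r₀ T a₀ : ℤ} (hN : 8 * (N : ℝ) + 16 ≤ n) (hN' : (n : ℝ) < 8 * N + 24)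
    (hN7 : (7 : ℝ) ≤ N) (hr₀ : 3 * (r₀ : ℝ) ≤ 2 * w.im - 1) (hr₀' : 2 * w.im - 4 < 3 * r₀)
    (hT : 2 * w.re * Real.sqrt 3 / 3 ≤ T) (hT' : (T : ℝ) < 2 * w.re * Real.sqrt 3 / 3 + 1)
    (ha₀ : ((T : ℝ) + N + 5 - r₀) / 2 ≤ a₀) (ha₀' : (a₀ : ℝ) < (T + N + 5 - r₀) / 2 + 1) :
    (∀ x : Site 2, 2 * a₀ + r₀ - N ≤ 2 * x 0 + x 1 → 2 * x 0 + x 1 ≤ 2 * a₀ + r₀ + 8 * N + 1 →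
      (triIsoradialEmbedding.z x - w).re ∈ Set.Icc (2 * Real.sqrt 3) (n - 3 * Real.sqrt 3 / 2)) ∧
    (∀ x : Site 2, 2 * a₀ + r₀ - N ≤ 2 * x 0 + x 1 → 2 * x 0 + x 1 ≤ 2 * a₀ + r₀ + 8 * N →
      (triIsoradialEmbedding.z x - w).re ∈ Set.Icc (2 * Real.sqrt 3) (n - 2 * Real.sqrt 3)) ∧
    (∀ x : Site 2, x 1 = r₀ → (triIsoradialEmbedding.z x - w).im ≤ -1) ∧
    (∀ x : Site 2, x 1 = r₀ + 16 * N → 2 * (n : ℝ) ≤ (triIsoradialEmbedding.z x - w).im) := by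
  set s := Real.sqrt 3 with hs
  have hs0 : 0 < s := lt_trans (by norm_num) sqrt3_gt
  have hs74 := sqrt3_lt
  have hss : Real.sqrt 3 * Real.sqrt 3 = 3 := Real.mul_self_sqrt (by norm_num)
  have key : s * (2 * w.re * s / 3) = 2 * w.re := by
    rw [show s * (2 * w.re * s / 3) = 2 * w.re * (s * s) / 3 by ring, hss]; ring
  -- the lower end of the strip
  have lo : ∀ x : Site 2, 2 * a₀ + r₀ - N ≤ 2 * x 0 + x 1 →
      2 * s ≤ (triIsoradialEmbedding.z x - w).re := fun x h => by
    rw [Complex.sub_re, z_re]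
    have h' : 2 * (a₀ : ℝ) + r₀ - N ≤ 2 * x 0 + x 1 := by exact_mod_cast h
    have i1 : s * (T + 4 : ℝ) ≤ s * (2 * x 0 + x 1 - 1) := mul_le_mul_of_nonneg_left (by linarith) hs0.le
    have i2 : s * (2 * w.re * s / 3) ≤ s * T := mul_le_mul_of_nonneg_left hT hs0.le
    show 2 * s ≤ s / 2 * (2 * (x 0 : ℝ) + x 1 - 1) - w.re
    nlinarith
  -- the upper end of the strip
  have hi : ∀ x : Site 2, 2 * x 0 + x 1 ≤ 2 * a₀ + r₀ + 8 * N + 1 →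
      (triIsoradialEmbedding.z x - w).re ≤ n - 3 * s / 2 := fun x h => by
    rw [Complex.sub_re, z_re]
    have h' : 2 * (x 0 : ℝ) + x 1 ≤ 2 * a₀ + r₀ + 8 * N + 1 := by exact_mod_cast h
    have i1 : s * (2 * (x 0 : ℝ) + x 1 - 1) ≤ s * (T + 9 * N + 7) :=
      mul_le_mul_of_nonneg_left (by linarith) hs0.le
    have i2 : s * (T : ℝ) ≤ s * (2 * w.re * s / 3 + 1) := mul_le_mul_of_nonneg_left hT'.le hs0.le
    have i3 : s * (9 * (N : ℝ) + 11) ≤ 2 * n := by nlinarith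
    show s / 2 * (2 * (x 0 : ℝ) + x 1 - 1) - w.re ≤ n - 3 * s / 2
    nlinarith
  have hi' : ∀ x : Site 2, 2 * x 0 + x 1 ≤ 2 * a₀ + r₀ + 8 * N →
      (triIsoradialEmbedding.z x - w).re ≤ n - 2 * s := fun x h => by
    rw [Complex.sub_re, z_re]
    have h' : 2 * (x 0 : ℝ) + x 1 ≤ 2 * a₀ + r₀ + 8 * N := by exact_mod_cast h
    have i1 : s * (2 * (x 0 : ℝ) + x 1 - 1) ≤ s * (T + 9 * N + 6) :=
      mul_le_mul_of_nonneg_left (by linarith) hs0.le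
    have i2 : s * (T : ℝ) ≤ s * (2 * w.re * s / 3 + 1) := mul_le_mul_of_nonneg_left hT'.le hs0.le
    have i3 : s * (9 * (N : ℝ) + 11) ≤ 2 * n := by nlinarith
    show s / 2 * (2 * (x 0 : ℝ) + x 1 - 1) - w.re ≤ n - 2 * s
    nlinarith
  refine ⟨fun x h1 h2 => ⟨lo x h1, hi x h2⟩, fun x h1 h2 => ⟨lo x h1, hi' x h2⟩, fun x h1 => ?_,
    fun x h1 => ?_⟩
  · rw [Complex.sub_im, z_im, h1]
    linarith
  · rw [Complex.sub_im, z_im, h1]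
    push_cast
    linarith

end Summit.CriticalPhenomena.CardyFormulaZ2.Theorems.TriSweep

end
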